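import Summits.BirchSwinnertonDyer.BirchSwinnertonDyer.Theses.PrintCf2
import Summits.BirchSwinnertonDyer.BirchSwinnertonDyer.Theorems.PrintCf2SplitBadTwoHalvesOfHeegnerIndexAtTwo
import Summits.BirchSwinnertonDyer.BirchSwinnertonDyer.Theorems.PrintCf2SplitBadEisensteinTwoBdpComposition
import Literature.NumberTheory.EllipticCurves.Milne1972.WeilRestrictionQuadraticBSDQuotientOfAnyModelProofs
import HarnessLib

/-!
# Crux `PrintCf2.SplitBadTwoRankOneOfFacts` (item 20368) and its halves 27850 / 27851 BY NAME from the FACTS-RELATIVE INDEX STUBS of line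
# `heegner_index_two` (companion of the route-independent `PrintCf2SplitBadTwoHalvesOfHeegnerIndexAtTwo`, p638495)

Cell `bsd-print-cf2`, seat `bsd-line-cf2-p1` g8 (LEAD on crux stmt-BirchSwinnertonDyer-20368). `--supports stmt-BirchSwinnertonDyer-20368`
(helper). THEOREMS ONLY (0 definitions, 0 named facts, 0 `sorry`); CONDITIONAL on every displayed hypothesis. BSD is proved for no curve by
any of this; no summit statement is proved by this seat.

The research stubs of line `heegner_index_two` (children skeletons v3, registered by the LEAD after planner g16's RULING (x) and its typing
checklist PLAN §5 v1.28) are FACTS-RELATIVE and DISPLAY everything the prints give on a Heegner frame: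
  `stub_heegnerIndexUpperAtTwo : (ToricPublishedInputs ∧ Milne any-model) → 𝔅_split → ∀ W in the class, ∀ Heegner frame (N, K, Dt, H, ι, P)
     [N_W = N, K imaginary quadratic, Heegner hypothesis, d_K < −4, L(E^{d_K},1) ≠ 0, r_an(E_K) = 1, P the Heegner point of Dt/H,
      P non-torsion, rank E(K) = 1, Ш(E/K) finite], ord₂ #Ш(E/K)[2^∞] + ord₂ c_K ≤ 2·ord₂ [E(K):ℤP] − 2·ord₂ c`
  `stub_heegnerIndexLowerAtTwo`: the same with `2·ord₂ [E(K):ℤP] − 2·ord₂ c ≤ ord₂ #Ш(E/K)[2^∞] + ord₂ c_K`.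
This file turns each such stub into its child crux BY NAME (and both into the parent):
* `heegnerIndexUpperBound_of_displayed` / `heegnerIndexLowerBound_of_displayed` — for one `W` with `r_an(W) = 1`: the DISPLAYED per-`W` binder
  (with `L(E^{d_K},1) ≠ 0` and `r_an(E_K) = 1` among the hypotheses) gives the bare binder of p638495's §2 (Gross–Zagier: `P` non-torsion ⟹
  `L'(E/K,1) ≠ 0` ⟹ `L(E^{d_K},1) ≠ 0`; `r_an(E_K) = r_an(E) + r_an(E^{d_K}) = 1`);
* `splitBadTwoUpperHalfOfFacts_of_heegnerIndexStub` / `splitBadTwoLowerHalfOfFacts_of_heegnerIndexStub` — child cruxes 27850 / 27851 from the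
  cite-level stub `ToricPublishedInputs ∧ Milne any-model` + the research stub of that half (twin `BSD₂` = 𝔅_split's Burungale–Flach + modularity,
  `rankZeroTwistBSDp_two_of_hasCM_of_print`);
* `splitBadTwoRankOneOfFacts_of_heegnerIndexStubs` — the parent 20368 from both (glue 27852's bookkeeping inlined).

References: [Kolyvagin1990] Thm. A; [GrossZagier1986] V.(2.2); [Gross1991] (1.1), Thm. 1.3; [Milne1972ArithmeticAV] §1 Thm. 1; [Miller2011LMS]
Def. 1.1; [JetchevSkinnerWan2017] §7.4.1 (shape of the lower half).
-/

set_option autoImplicit false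

-- D-0017 layout: summit = sub-problem, so `Summit.BirchSwinnertonDyer.BirchSwinnertonDyer.…` is the mandated namespace of Theorems files.
set_option linter.dupNamespace false

noncomputable section

open scoped Classical NumberField

namespace Summit.BirchSwinnertonDyer.BirchSwinnertonDyer.Theorems.PrintCf2.EisensteinTwo

open WeierstrassCurve NumberField Literature.NumberTheory.EllipticCurves Literature.NumberTheory.EllipticCurves.ModularForms
  Literature.NumberTheory.EllipticCurves.Rank1Residual Literature.NumberTheory.EllipticCurves.Rank1Residual.Typed
  Literature.NumberTheory.EllipticCurves.KrizLi2019
  Summit.BirchSwinnertonDyer.Rank1Residual Summit.BirchSwinnertonDyer.Rank1Residual.AdditivePotMult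
  Summit.BirchSwinnertonDyer.BirchSwinnertonDyer.Theses.UniversalToricDescent

/-! ### §1 The displayed per-`W` binder gives the bare one (Gross–Zagier bookkeeping) -/

/-- **Displayed ⟹ bare, UPPER.** For one `W` with `r_an(W) = 1`, GIVEN the toric prints `hF` (Gross–Zagier and modularity are used): if the
UPPER index bound holds on every Heegner frame of `W` under the DISPLAYED hypotheses (including `L(E^{d_K},1) ≠ 0` and `r_an(E_K) = 1`), it holds
on every Heegner frame with `P` non-torsion — because `P` non-torsion ⟹ `L'(E/K,1) ≠ 0` (Gross–Zagier, `lDerivEK_ne_zero_iff_not_isOfFinAddOrder`)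
⟹ `L(E^{d_K},1) ≠ 0` (`L'(E/K,1) = L'(E,1)·L(E^{d_K},1)`), and then `r_an(E_K) = 1 + 0`. [cite: GrossZagier1986, Thm. I.6.3, V.(2.2)] [cite: Gross1991, (1.1)] -/
theorem heegnerIndexUpperBound_of_displayed (hF : ToricPublishedInputs)
    (W : WeierstrassCurve ℚ) [W.IsElliptic] [W.IsGloballyMinimal] (hr : W.analyticRank = 1)
    (hU : ∀ (N : ℕ) [NeZero N] (K : Type) [Field K] [NumberField K] (Dt : ModularParametrizationData W N)
        (H : HeegnerDatum N (NumberField.discr K)) (ι : K →+* ℂ) (P : (W.baseChange K).toAffine.Point),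
        W.conductorNorm ℤ = N → IsImaginaryQuadratic K → SatisfiesHeegnerHypothesis N K → NumberField.discr K < -4 →
        (W.quadraticTwist (NumberField.discr K : ℚ)).entireLFunction 1 ≠ 0 → (W.baseChange K).analyticRank = 1 →
        WeierstrassCurve.Affine.Point.map ι.toRatAlgHom P = heegnerPointComplex Dt H → ¬ IsOfFinAddOrder P →
        (W.baseChange K).mordellWeilRank = 1 → Finite (W.baseChange K).sha →
        (padicValNat 2 (Nat.card (AddCommGroup.primaryComponent (W.baseChange K).sha 2)) : ℤ) +
            (padicValNat 2 (W.baseChange K).tamagawaProduct : ℤ) ≤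
          2 * (padicValNat 2 (AddSubgroup.zmultiples P).index : ℤ) - 2 * (padicValNat 2 Dt.c.natAbs : ℤ)) :
    ∀ (N : ℕ) [NeZero N] (K : Type) [Field K] [NumberField K] (Dt : ModularParametrizationData W N)
        (H : HeegnerDatum N (NumberField.discr K)) (ι : K →+* ℂ) (P : (W.baseChange K).toAffine.Point),
        W.conductorNorm ℤ = N → IsImaginaryQuadratic K → SatisfiesHeegnerHypothesis N K → NumberField.discr K < -4 →
        WeierstrassCurve.Affine.Point.map ι.toRatAlgHom P = heegnerPointComplex Dt H → ¬ IsOfFinAddOrder P →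
        (W.baseChange K).mordellWeilRank = 1 → Finite (W.baseChange K).sha →
        (padicValNat 2 (Nat.card (AddCommGroup.primaryComponent (W.baseChange K).sha 2)) : ℤ) +
            (padicValNat 2 (W.baseChange K).tamagawaProduct : ℤ) ≤
          2 * (padicValNat 2 (AddSubgroup.zmultiples P).index : ℤ) - 2 * (padicValNat 2 Dt.c.natAbs : ℤ) := by
  intro N _ K _ _ Dt H ι P hN hK hHN hd4 hP hnt hrk hfin
  obtain ⟨hGZ, -, -, hmod, -⟩ := hF
  subst hN
  have hL0 : W.entireLFunction 1 = 0 := entireLFunction_one_eq_zero_of_analyticRank_eq_one hr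
  have hLK : LDerivEK W K ≠ 0 :=
    (lDerivEK_ne_zero_iff_not_isOfFinAddOrder W (W.conductorNorm ℤ) K (hGZ _ W K) hK hHN ⟨Dt, H, ι, hP⟩).mpr hnt
  have hLt : (W.quadraticTwist (NumberField.discr K : ℚ)).entireLFunction 1 ≠ 0 := by
    intro h0
    apply hLK
    rw [lDerivEK_eq_deriv_mul W K hmod hL0, h0, mul_zero]
  have h2 : Module.finrank ℚ K = 2 := hK.1
  have hD0 : (NumberField.discr K : ℚ) ≠ 0 := by exact_mod_cast NumberField.discr_ne_zero K
  haveI hEt : (W.quadraticTwist (NumberField.discr K : ℚ)).IsElliptic := W.isElliptic_quadraticTwist hD0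
  have hrd0 : (W.quadraticTwist (NumberField.discr K : ℚ)).analyticRank = 0 :=
    ((W.quadraticTwist (NumberField.discr K : ℚ)).analyticRank_eq_zero_iff_holds (hmod _)).mpr hLt
  have hrK : (W.baseChange K).analyticRank = 1 :=
    (Summit.BirchSwinnertonDyer.Rank1Residual.P2.analyticRank_baseChange_eq_one_iff W K hmod h2).mpr (Or.inl ⟨hr, hrd0⟩)
  exact hU (W.conductorNorm ℤ) K Dt H ι P rfl hK hHN hd4 hLt hrK hP hnt hrk hfin

/-- **Displayed ⟹ bare, LOWER.** For one `W` with `r_an(W) = 1`, GIVEN the toric prints `hF` (Gross–Zagier and modularity are used): if the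
LOWER index bound holds on every Heegner frame of `W` under the DISPLAYED hypotheses (including `L(E^{d_K},1) ≠ 0` and `r_an(E_K) = 1`), it holds
on every Heegner frame with `P` non-torsion — because `P` non-torsion ⟹ `L'(E/K,1) ≠ 0` (Gross–Zagier, `lDerivEK_ne_zero_iff_not_isOfFinAddOrder`)
⟹ `L(E^{d_K},1) ≠ 0` (`L'(E/K,1) = L'(E,1)·L(E^{d_K},1)`), and then `r_an(E_K) = 1 + 0`. [cite: GrossZagier1986, Thm. I.6.3, V.(2.2)] [cite: Gross1991, (1.1)] -/
theorem heegnerIndexLowerBound_of_displayed (hF : ToricPublishedInputs)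
    (W : WeierstrassCurve ℚ) [W.IsElliptic] [W.IsGloballyMinimal] (hr : W.analyticRank = 1)
    (hD : ∀ (N : ℕ) [NeZero N] (K : Type) [Field K] [NumberField K] (Dt : ModularParametrizationData W N)
        (H : HeegnerDatum N (NumberField.discr K)) (ι : K →+* ℂ) (P : (W.baseChange K).toAffine.Point),
        W.conductorNorm ℤ = N → IsImaginaryQuadratic K → SatisfiesHeegnerHypothesis N K → NumberField.discr K < -4 →
        (W.quadraticTwist (NumberField.discr K : ℚ)).entireLFunction 1 ≠ 0 → (W.baseChange K).analyticRank = 1 →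
        WeierstrassCurve.Affine.Point.map ι.toRatAlgHom P = heegnerPointComplex Dt H → ¬ IsOfFinAddOrder P →
        (W.baseChange K).mordellWeilRank = 1 → Finite (W.baseChange K).sha →
        2 * (padicValNat 2 (AddSubgroup.zmultiples P).index : ℤ) - 2 * (padicValNat 2 Dt.c.natAbs : ℤ) ≤
          (padicValNat 2 (Nat.card (AddCommGroup.primaryComponent (W.baseChange K).sha 2)) : ℤ) +
            (padicValNat 2 (W.baseChange K).tamagawaProduct : ℤ)) :
    ∀ (N : ℕ) [NeZero N] (K : Type) [Field K] [NumberField K] (Dt : ModularParametrizationData W N)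
        (H : HeegnerDatum N (NumberField.discr K)) (ι : K →+* ℂ) (P : (W.baseChange K).toAffine.Point),
        W.conductorNorm ℤ = N → IsImaginaryQuadratic K → SatisfiesHeegnerHypothesis N K → NumberField.discr K < -4 →
        WeierstrassCurve.Affine.Point.map ι.toRatAlgHom P = heegnerPointComplex Dt H → ¬ IsOfFinAddOrder P →
        (W.baseChange K).mordellWeilRank = 1 → Finite (W.baseChange K).sha →
        2 * (padicValNat 2 (AddSubgroup.zmultiples P).index : ℤ) - 2 * (padicValNat 2 Dt.c.natAbs : ℤ) ≤
          (padicValNat 2 (Nat.card (AddCommGroup.primaryComponent (W.baseChange K).sha 2)) : ℤ) +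
            (padicValNat 2 (W.baseChange K).tamagawaProduct : ℤ) := by
  intro N _ K _ _ Dt H ι P hN hK hHN hd4 hP hnt hrk hfin
  obtain ⟨hGZ, -, -, hmod, -⟩ := hF
  subst hN
  have hL0 : W.entireLFunction 1 = 0 := entireLFunction_one_eq_zero_of_analyticRank_eq_one hr
  have hLK : LDerivEK W K ≠ 0 :=
    (lDerivEK_ne_zero_iff_not_isOfFinAddOrder W (W.conductorNorm ℤ) K (hGZ _ W K) hK hHN ⟨Dt, H, ι, hP⟩).mpr hnt
  have hLt : (W.quadraticTwist (NumberField.discr K : ℚ)).entireLFunction 1 ≠ 0 := by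
    intro h0
    apply hLK
    rw [lDerivEK_eq_deriv_mul W K hmod hL0, h0, mul_zero]
  have h2 : Module.finrank ℚ K = 2 := hK.1
  have hD0 : (NumberField.discr K : ℚ) ≠ 0 := by exact_mod_cast NumberField.discr_ne_zero K
  haveI hEt : (W.quadraticTwist (NumberField.discr K : ℚ)).IsElliptic := W.isElliptic_quadraticTwist hD0
  have hrd0 : (W.quadraticTwist (NumberField.discr K : ℚ)).analyticRank = 0 :=
    ((W.quadraticTwist (NumberField.discr K : ℚ)).analyticRank_eq_zero_iff_holds (hmod _)).mpr hLt
  have hrK : (W.baseChange K).analyticRank = 1 :=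
    (Summit.BirchSwinnertonDyer.Rank1Residual.P2.analyticRank_baseChange_eq_one_iff W K hmod h2).mpr (Or.inl ⟨hr, hrd0⟩)
  exact hD (W.conductorNorm ℤ) K Dt H ι P rfl hK hHN hd4 hLt hrK hP hnt hrk hfin

/-! ### §2 Class level, BY NAME: child cruxes 27850 / 27851 and the parent 20368 from the facts-relative index stubs -/

/-- **Child crux `PrintCf2.SplitBadTwoUpperHalfOfFacts` (item 27850) FROM the cite-level stub `hPr` (`ToricPublishedInputs` ∧ Milne 1972 §1
Thm. 1 any-model) AND the FACTS-RELATIVE UPPER INDEX STUB `hU`** (`stub_heegnerIndexUpperAtTwo` of line `heegner_index_two`, verbatim). The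
twin's `BSD₂` is 𝔅_split's Burungale–Flach + modularity (`rankZeroTwistBSDp_two_of_hasCM_of_print`); the half over `ℚ` is p638495's
`missingUpperBoundAt_two_of_heegnerIndexBound_of_twist`. CONDITIONAL on `hPr`, `hU`.
[cite: Kolyvagin1990, Thm. A (shape)] [cite: Milne1972ArithmeticAV, §1 Thm. 1] [cite: Miller2011LMS, Def. 1.1] -/
theorem splitBadTwoUpperHalfOfFacts_of_heegnerIndexStub
    (hPr : (ToricPublishedInputs ∧ Milne1972.bsdQuotient_baseChange_quadratic_anyModel))
    (hU : (ToricPublishedInputs ∧ Milne1972.bsdQuotient_baseChange_quadratic_anyModel) →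
      (Literature.NumberTheory.EllipticCurves.rank_eq_analyticRank_of_analyticRank_le_one ∧ WeierstrassCurve.hasEntireLFunction_rat ∧
        WeierstrassCurve.bsdRHS_eq_of_isIsogenous ∧ Literature.NumberTheory.EllipticCurves.bsdTriple_of_hasCM_of_L_one_ne_zero ∧
        Literature.NumberTheory.EllipticCurves.KrizLi2019.thm112_bsdTwo_twist) →
      ∀ (W : WeierstrassCurve ℚ) [W.IsElliptic] [W.IsGloballyMinimal], W.HasCM → W.analyticRank = 1 → CMSplit W 2 → ¬ Good W 2 →
        ∀ (N : ℕ) [NeZero N] (K : Type) [Field K] [NumberField K] (Dt : ModularParametrizationData W N)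
          (H : HeegnerDatum N (NumberField.discr K)) (ι : K →+* ℂ) (P : (W.baseChange K).toAffine.Point),
          W.conductorNorm ℤ = N → IsImaginaryQuadratic K → SatisfiesHeegnerHypothesis N K → NumberField.discr K < -4 →
          (W.quadraticTwist (NumberField.discr K : ℚ)).entireLFunction 1 ≠ 0 → (W.baseChange K).analyticRank = 1 →
          WeierstrassCurve.Affine.Point.map ι.toRatAlgHom P = heegnerPointComplex Dt H → ¬ IsOfFinAddOrder P →
          (W.baseChange K).mordellWeilRank = 1 → Finite (W.baseChange K).sha →
          (padicValNat 2 (Nat.card (AddCommGroup.primaryComponent (W.baseChange K).sha 2)) : ℤ) +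
              (padicValNat 2 (W.baseChange K).tamagawaProduct : ℤ) ≤
            2 * (padicValNat 2 (AddSubgroup.zmultiples P).index : ℤ) - 2 * (padicValNat 2 Dt.c.natAbs : ℤ)) :
    Summit.BirchSwinnertonDyer.BirchSwinnertonDyer.Theses.PrintCf2.SplitBadTwoUpperHalfOfFacts := by
  intro hB W _ _ hCM hr hsplit hng
  exact missingUpperBoundAt_two_of_heegnerIndexBound_of_twist hPr.1 (Milne1972.bsdQuotient_baseChange_quadratic_of_anyModel hPr.2) W hr
    (heegnerIndexUpperBound_of_displayed hPr.1 W hr (hU hPr hB W hCM hr hsplit hng))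
    (PrintCf2.rankZeroTwistBSDp_two_of_hasCM_of_print hB.2.2.2.1 hB.2.1 W hCM)

/-- **Child crux `PrintCf2.SplitBadTwoLowerHalfOfFacts` (item 27851) FROM the cite-level stub `hPr` AND the FACTS-RELATIVE LOWER INDEX STUB
`hD`** (`stub_heegnerIndexLowerAtTwo` of line `heegner_index_two`, verbatim); the half over `ℚ` is p638495's
`missingLowerBoundAt_two_of_heegnerIndexBound_of_twist`. CONDITIONAL on `hPr`, `hD`.
[cite: JetchevSkinnerWan2017, §7.4.1 (shape)] [cite: Milne1972ArithmeticAV, §1 Thm. 1] [cite: Miller2011LMS, Def. 1.1] -/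
theorem splitBadTwoLowerHalfOfFacts_of_heegnerIndexStub
    (hPr : (ToricPublishedInputs ∧ Milne1972.bsdQuotient_baseChange_quadratic_anyModel))
    (hD : (ToricPublishedInputs ∧ Milne1972.bsdQuotient_baseChange_quadratic_anyModel) →
      (Literature.NumberTheory.EllipticCurves.rank_eq_analyticRank_of_analyticRank_le_one ∧ WeierstrassCurve.hasEntireLFunction_rat ∧
        WeierstrassCurve.bsdRHS_eq_of_isIsogenous ∧ Literature.NumberTheory.EllipticCurves.bsdTriple_of_hasCM_of_L_one_ne_zero ∧
        Literature.NumberTheory.EllipticCurves.KrizLi2019.thm112_bsdTwo_twist) →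
      ∀ (W : WeierstrassCurve ℚ) [W.IsElliptic] [W.IsGloballyMinimal], W.HasCM → W.analyticRank = 1 → CMSplit W 2 → ¬ Good W 2 →
        ∀ (N : ℕ) [NeZero N] (K : Type) [Field K] [NumberField K] (Dt : ModularParametrizationData W N)
          (H : HeegnerDatum N (NumberField.discr K)) (ι : K →+* ℂ) (P : (W.baseChange K).toAffine.Point),
          W.conductorNorm ℤ = N → IsImaginaryQuadratic K → SatisfiesHeegnerHypothesis N K → NumberField.discr K < -4 →
          (W.quadraticTwist (NumberField.discr K : ℚ)).entireLFunction 1 ≠ 0 → (W.baseChange K).analyticRank = 1 →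
          WeierstrassCurve.Affine.Point.map ι.toRatAlgHom P = heegnerPointComplex Dt H → ¬ IsOfFinAddOrder P →
          (W.baseChange K).mordellWeilRank = 1 → Finite (W.baseChange K).sha →
          2 * (padicValNat 2 (AddSubgroup.zmultiples P).index : ℤ) - 2 * (padicValNat 2 Dt.c.natAbs : ℤ) ≤
            (padicValNat 2 (Nat.card (AddCommGroup.primaryComponent (W.baseChange K).sha 2)) : ℤ) +
              (padicValNat 2 (W.baseChange K).tamagawaProduct : ℤ)) :
    Summit.BirchSwinnertonDyer.BirchSwinnertonDyer.Theses.PrintCf2.SplitBadTwoLowerHalfOfFacts := by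
  intro hB W _ _ hCM hr hsplit hng
  exact missingLowerBoundAt_two_of_heegnerIndexBound_of_twist hPr.1 (Milne1972.bsdQuotient_baseChange_quadratic_of_anyModel hPr.2) W hr
    (heegnerIndexLowerBound_of_displayed hPr.1 W hr (hD hPr hB W hCM hr hsplit hng))
    (PrintCf2.rankZeroTwistBSDp_two_of_hasCM_of_print hB.2.2.2.1 hB.2.1 W hCM)

/-- **The parent crux `PrintCf2.SplitBadTwoRankOneOfFacts` (item 20368) FROM the cite-level stub AND BOTH FACTS-RELATIVE INDEX STUBS** — the two
halves make `MissingPPartAt W 2` (`missingPPartAt_of_lower_of_upper`) and GZK (first conjunct of 𝔅_split) turns it into `BSDp W 2`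
(`bsdp_of_missingPPartAt`): glue item 27852's bookkeeping inlined. CONDITIONAL on `hPr`, `hU`, `hD`.
[cite: Miller2011LMS, Def. 1.1] [cite: GrossZagier1986, V.(2.2)] [cite: Kolyvagin1990, Thm. A (shape)] -/
theorem splitBadTwoRankOneOfFacts_of_heegnerIndexStubs
    (hPr : (ToricPublishedInputs ∧ Milne1972.bsdQuotient_baseChange_quadratic_anyModel))
    (hU : (ToricPublishedInputs ∧ Milne1972.bsdQuotient_baseChange_quadratic_anyModel) →
      (Literature.NumberTheory.EllipticCurves.rank_eq_analyticRank_of_analyticRank_le_one ∧ WeierstrassCurve.hasEntireLFunction_rat ∧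
        WeierstrassCurve.bsdRHS_eq_of_isIsogenous ∧ Literature.NumberTheory.EllipticCurves.bsdTriple_of_hasCM_of_L_one_ne_zero ∧
        Literature.NumberTheory.EllipticCurves.KrizLi2019.thm112_bsdTwo_twist) →
      ∀ (W : WeierstrassCurve ℚ) [W.IsElliptic] [W.IsGloballyMinimal], W.HasCM → W.analyticRank = 1 → CMSplit W 2 → ¬ Good W 2 →
        ∀ (N : ℕ) [NeZero N] (K : Type) [Field K] [NumberField K] (Dt : ModularParametrizationData W N)
          (H : HeegnerDatum N (NumberField.discr K)) (ι : K →+* ℂ) (P : (W.baseChange K).toAffine.Point),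
          W.conductorNorm ℤ = N → IsImaginaryQuadratic K → SatisfiesHeegnerHypothesis N K → NumberField.discr K < -4 →
          (W.quadraticTwist (NumberField.discr K : ℚ)).entireLFunction 1 ≠ 0 → (W.baseChange K).analyticRank = 1 →
          WeierstrassCurve.Affine.Point.map ι.toRatAlgHom P = heegnerPointComplex Dt H → ¬ IsOfFinAddOrder P →
          (W.baseChange K).mordellWeilRank = 1 → Finite (W.baseChange K).sha →
          (padicValNat 2 (Nat.card (AddCommGroup.primaryComponent (W.baseChange K).sha 2)) : ℤ) +
              (padicValNat 2 (W.baseChange K).tamagawaProduct : ℤ) ≤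
            2 * (padicValNat 2 (AddSubgroup.zmultiples P).index : ℤ) - 2 * (padicValNat 2 Dt.c.natAbs : ℤ))
    (hD : (ToricPublishedInputs ∧ Milne1972.bsdQuotient_baseChange_quadratic_anyModel) →
      (Literature.NumberTheory.EllipticCurves.rank_eq_analyticRank_of_analyticRank_le_one ∧ WeierstrassCurve.hasEntireLFunction_rat ∧
        WeierstrassCurve.bsdRHS_eq_of_isIsogenous ∧ Literature.NumberTheory.EllipticCurves.bsdTriple_of_hasCM_of_L_one_ne_zero ∧
        Literature.NumberTheory.EllipticCurves.KrizLi2019.thm112_bsdTwo_twist) →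
      ∀ (W : WeierstrassCurve ℚ) [W.IsElliptic] [W.IsGloballyMinimal], W.HasCM → W.analyticRank = 1 → CMSplit W 2 → ¬ Good W 2 →
        ∀ (N : ℕ) [NeZero N] (K : Type) [Field K] [NumberField K] (Dt : ModularParametrizationData W N)
          (H : HeegnerDatum N (NumberField.discr K)) (ι : K →+* ℂ) (P : (W.baseChange K).toAffine.Point),
          W.conductorNorm ℤ = N → IsImaginaryQuadratic K → SatisfiesHeegnerHypothesis N K → NumberField.discr K < -4 →
          (W.quadraticTwist (NumberField.discr K : ℚ)).entireLFunction 1 ≠ 0 → (W.baseChange K).analyticRank = 1 →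
          WeierstrassCurve.Affine.Point.map ι.toRatAlgHom P = heegnerPointComplex Dt H → ¬ IsOfFinAddOrder P →
          (W.baseChange K).mordellWeilRank = 1 → Finite (W.baseChange K).sha →
          2 * (padicValNat 2 (AddSubgroup.zmultiples P).index : ℤ) - 2 * (padicValNat 2 Dt.c.natAbs : ℤ) ≤
            (padicValNat 2 (Nat.card (AddCommGroup.primaryComponent (W.baseChange K).sha 2)) : ℤ) +
              (padicValNat 2 (W.baseChange K).tamagawaProduct : ℤ)) :
    Summit.BirchSwinnertonDyer.BirchSwinnertonDyer.Theses.PrintCf2.SplitBadTwoRankOneOfFacts := by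
  intro hB W _ _ hCM hr hsplit hng
  exact bsdp_of_missingPPartAt W 2 hB.1 (by rw [hr])
    (missingPPartAt_of_lower_of_upper W 2
      (splitBadTwoLowerHalfOfFacts_of_heegnerIndexStub hPr hD hB W hCM hr hsplit hng)
      (splitBadTwoUpperHalfOfFacts_of_heegnerIndexStub hPr hU hB W hCM hr hsplit hng))

end Summit.BirchSwinnertonDyer.BirchSwinnertonDyer.Theorems.PrintCf2.EisensteinTwo

end
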